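import Literature.AlgebraicGeometry.HodgeTheory.SemiregularVariationalHodgeTwistedPerfect
import Literature.AlgebraicGeometry.Hyperkaehler.BeauvilleBogomolovForm
import Literature.AlgebraicTopology.SingularHomology.CupProductProofs
import Mathlib.RingTheory.Nilpotent.Exp
import HarnessLib

/-!
# The exponential law `e^{B + B'} ∪ κ = e^{B} ∪ (e^{B'} ∪ κ)` for the `B`-twist of a family of even classes

Family `hodge`, layer `Literature/AlgebraicGeometry/HodgeTheory`. THEOREMS ONLY (no new notion, no named fact) about the
tree's `expTwistClasses X B κ k = Σ_{i ≤ k} (1/i!) Bⁱ ∪ κ_{k-i}`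
(`Literature/AlgebraicGeometry/HodgeTheory/SemiregularVariationalHodgeTwistedPerfect.lean` §2; the twisted Chern character
`ch^B = ch · exp(B)` of Huybrechts–Stellari, the class `exp(B₀) · ch(E₀)` of Perry's semiregularity theorem, Markman's
`κ(E) = ch(E) · exp(-c₁(E)/r)`), in ALL degrees `k`:

* §1 cup algebra of degree-two classes: `xⁱ ∪ xʲ = x^{i+j}` (free target degree), `x ∪ y = y ∪ x`,
  `x ∪ (y ∪ z) = y ∪ (x ∪ z)` (graded commutativity in even degrees, `cupProduct_gradedComm_holds`);
* §2 **`expTwistClasses_add`**: `(e^{B+B'} ∪ κ)_k = (e^{B} ∪ (e^{B'} ∪ κ))_k`, with the corollaries `e^{-B} ∪ (e^{B} ∪ κ) = κ`,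
  `e^{B} ∪ (e^{-B} ∪ κ) = κ`, change of `B`-field, commutation of two twists, injectivity, and linearity of the twist in the
  family `κ`. Device of the proof (kept inside it — no auxiliary notion is declared): on the truncated families `(κ_j)_{j ≤ k}`
  the twist by `B` is `exp` of the NILPOTENT linear operator `L_B : (κ_j) ↦ (B ∪ κ_{j-1})` (`(L_B^i κ)_j = Bⁱ ∪ κ_{j-i}`,
  `L_B^{k+1} = 0`, `L_B L_{B'} = L_{B'} L_B`, `L_{B+B'} = L_B + L_{B'}`), so that Mathlib's `IsNilpotent.exp_add_of_commute` — the
  exponential law for commuting nilpotent elements of a `ℚ`-algebra — applies in the endomorphism ring;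
* §3 the components in degrees `0` and `1`: `(e^{B} ∪ κ)_0 = κ_0`, `(e^{B} ∪ κ)_1 = κ_1 + B ∪ κ_0`;
* §4 **ray stability**: if `κ_q ∈ ℂ·θ^q` for all `q < p`, then for every `t ∈ ℂ` the twist by `t·θ` keeps `(e^{tθ} ∪ κ)_q ∈ ℂ·θ^q`
  for `q < p` and changes `κ_p` by a multiple of `θᵖ` only (the gauge computation behind Markman's normalisation
  `B₀ ↦ B₀ - c₁/r`, which moves the `B`-field along the polarisation ray).

Sources. [cite: HuybrechtsStellari2005, §1] (`ch^B(E) = ch(E) · exp(B)`; `exp(B + B') = exp(B) exp(B')` in the even cohomology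
ring); [cite: HatcherAT2002, §3.2 and Thm. 3.11] (cup product ring, graded commutativity); [cite: Markman2025SecantWeil, §1.1 and §7.3]
(the `κ`-class and the change of `B`-field). The exponential law itself is folklore once graded commutativity is available; the
tree had only the case `B = 0` (`expTwistClasses_zero`).

What is NOT here: no Chern character, no sheaf, no door/object class; nothing about rationality or algebraicity beyond what
`SemiregularVariationalHodgeTwistedPerfect` already proves; no statement in odd degrees.
-/

noncomputable section

open Literature.AlgebraicTopology.SingularHomology
open Literature.AlgebraicGeometry.Motives

namespace Literature.AlgebraicGeometry.HodgeTheory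

/-! ### §1 Cup algebra of degree-two classes -/

section CupAlgebra

variable {Y : Type} [TopologicalSpace Y]

/-- **`xⁱ ∪ xʲ = x^{i+j}`** for the cup powers of a degree-`2` class, with a free target degree `2m`, `m = i + j`
(associativity of `⌣`). [cite: HatcherAT2002, §3.2] -/
theorem cupProduct_cupPowTwo_cupPowTwo (x : singularCohomology ℂ ℂ Y 2) {i j m : ℕ} (hm : i + j = m)
    (h : 2 * i + 2 * j = 2 * m) : cupProduct h (cupPowTwo x i) (cupPowTwo x j) = cupPowTwo x m := by
  subst hm
  induction j with
  | zero => exact cupProduct_one _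
  | succ j ih =>
    rw [cupPowTwo_succ x j]
    change _ = cupProduct (two_mul_add_two (i + j)) (cupPowTwo x (i + j)) x
    rw [← ih (by omega)]
    exact (cupProduct_assoc (by omega) (two_mul_add_two j) (two_mul_add_two (i + j)) h _ _ _).symm

/-- **`x ∪ y = y ∪ x` for degree-`2` classes** (graded commutativity, `(-1)^{2·2} = 1`), free target degree.
[cite: HatcherAT2002, Thm. 3.11] -/
theorem cupProduct_comm_of_two {m : ℕ} (h : 2 + 2 = m) (x y : singularCohomology ℂ ℂ Y 2) :
    cupProduct h x y = cupProduct h y x := by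
  rw [cupProduct_gradedComm_holds ℂ Y h h x y]
  norm_num

/-- **`x ∪ (y ∪ z) = y ∪ (x ∪ z)`** for degree-`2` classes `x, y` and any `z` (associativity and `x ∪ y = y ∪ x`).
[cite: HatcherAT2002, §3.2 and Thm. 3.11] -/
theorem cupProduct_two_left_comm {q r s : ℕ} (h₂ : 2 + q = r) (h₁ : 2 + r = s) (x y : singularCohomology ℂ ℂ Y 2)
    (z : singularCohomology ℂ ℂ Y q) :
    cupProduct h₁ x (cupProduct h₂ y z) = cupProduct h₁ y (cupProduct h₂ x z) := by
  rw [← cupProduct_assoc (rfl : 2 + 2 = 4) h₂ (by omega : 4 + q = s) h₁ x y z,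
    ← cupProduct_assoc (rfl : 2 + 2 = 4) h₂ (by omega : 4 + q = s) h₁ y x z, cupProduct_comm_of_two]

end CupAlgebra

/-! ### §2 The exponential law

Device of the proof (kept INSIDE the proof, so that this file declares no auxiliary notion): on the truncated families
`(κ_j)_{j ≤ k}` the twist by `B` is the exponential `Σ_i L_B^i / i!` of the nilpotent `ℂ`-linear operator
`L_B : (κ_j)_j ↦ (B ∪ κ_{j-1})_j` (`(L_B^i κ)_j = Bⁱ ∪ κ_{j-i}`, `L_B^{k+1} = 0`); `L_B` and `L_{B'}` commute and `L_{B+B'} = L_B + L_{B'}`,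
so Mathlib's `IsNilpotent.exp_add_of_commute` (the exponential law for commuting nilpotent elements of a `ℚ`-algebra, here the
endomorphism ring with scalars restricted along `ℚ → ℂ`) gives `e^{L_{B+B'}} = e^{L_B} e^{L_{B'}}`. -/

section ExponentialLaw

variable (X : SchemeOver ℂ)

/-- Degree bookkeeping `2 + 2(j - 1) = 2j` for `j ≠ 0` (private plumbing). [folklore] -/
private theorem two_add_two_mul_pred {j : ℕ} (h : j ≠ 0) : 2 + 2 * (j - 1) = 2 * j := by
  omega

/-- Degree bookkeeping `2i + 2(j - i) = 2j` for `i ≤ j` (private plumbing). [folklore] -/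
private theorem two_mul_add_two_mul_sub_of_le {i j : ℕ} (h : i ≤ j) : 2 * i + 2 * (j - i) = 2 * j := by
  omega

/-- **THE EXPONENTIAL LAW `(e^{B+B'} ∪ κ)_k = (e^{B} ∪ (e^{B'} ∪ κ))_k`** in every degree `k`, for all degree-`2` classes
`B, B'` and every family of even classes `κ` — `exp(B + B') = exp(B) ∪ exp(B')` in the (commutative) even cohomology ring, i.e.
`ch^{B+B'} = (ch^{B'})^{B}` for twisted Chern characters. [cite: HuybrechtsStellari2005, §1] [cite: HatcherAT2002, §3.2 and Thm. 3.11] -/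
theorem expTwistClasses_add (B B' : complexBetti X 2) (κ : (j : ℕ) → complexBetti X (2 * j)) (k : ℕ) :
    expTwistClasses X (B + B') κ k = expTwistClasses X B (expTwistClasses X B' κ) k := by
  -- the twist operators `L_A`, `A ∈ H²`, on the truncated families `(κ_j)_{j ≤ k}`
  let L : complexBetti X 2 → Module.End ℂ ((j : Fin (k + 1)) → complexBetti X (2 * (j : ℕ))) := fun A =>
    { toFun := fun f j => if h : (j : ℕ) = 0 then 0 else cupProduct (two_add_two_mul_pred h) A (f ⟨(j : ℕ) - 1, by omega⟩)
      map_add' := fun f g => by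
        funext j
        by_cases h : (j : ℕ) = 0
        · simp only [dif_pos h, Pi.add_apply, add_zero]
        · simp only [dif_neg h, Pi.add_apply, map_add]
      map_smul' := fun c f => by
        funext j
        by_cases h : (j : ℕ) = 0
        · simp only [dif_pos h, Pi.smul_apply, smul_zero, RingHom.id_apply]
        · simp only [dif_neg h, Pi.smul_apply, map_smul, RingHom.id_apply] }
  have hL : ∀ A f j, L A f j =
      if h : (j : ℕ) = 0 then 0 else cupProduct (two_add_two_mul_pred h) A (f ⟨(j : ℕ) - 1, by omega⟩) := fun _ _ _ => rfl
  -- `(L_A^i κ)_j = Aⁱ ∪ κ_{j-i}` for `i ≤ j`, `0` otherwise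
  have hpow : ∀ A (i : ℕ) f (j : Fin (k + 1)), (L A ^ i) f j =
      if h : i ≤ (j : ℕ) then cupProduct (two_mul_add_two_mul_sub_of_le h) (cupPowTwo A i) (f ⟨(j : ℕ) - i, by omega⟩)
      else 0 := by
    intro A i
    induction i with
    | zero =>
      intro f j
      rw [pow_zero, Module.End.one_apply, dif_pos (Nat.zero_le _)]
      exact (one_cupProduct _).symm
    | succ i ih =>
      intro f j
      rw [pow_succ, Module.End.mul_apply, ih]
      by_cases hi : i + 1 ≤ (j : ℕ)
      · have hij : i ≤ (j : ℕ) := by omega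
        rw [dif_pos hij, dif_pos hi]
        simp only [hL]
        rw [dif_neg (show ((j : ℕ) - i) ≠ 0 by omega), cupPowTwo_succ]
        exact (cupProduct_assoc (two_mul_add_two i) (by omega) (by omega) (by omega) _ _ _).symm
      · rw [dif_neg hi]
        by_cases hij : i ≤ (j : ℕ)
        · rw [dif_pos hij]
          simp only [hL]
          rw [dif_pos (show ((j : ℕ) - i) = 0 by omega), map_zero]
        · rw [dif_neg hij]
  -- nilpotency `L_A^{k+1} = 0`
  have hnil : ∀ A, L A ^ (k + 1) = 0 := fun A => by
    refine LinearMap.ext fun f => funext fun j => ?_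
    have hj := j.2
    rw [hpow, dif_neg (by omega), LinearMap.zero_apply, Pi.zero_apply]
  -- `L_B L_{B'} = L_{B'} L_B`
  have hcomm : Commute (L B) (L B') := by
    refine LinearMap.ext fun f => funext fun j => ?_
    change L B (L B' f) j = L B' (L B f) j
    simp only [hL]
    by_cases h : (j : ℕ) = 0
    · rw [dif_pos h, dif_pos h]
    · rw [dif_neg h, dif_neg h]
      by_cases h' : (j : ℕ) - 1 = 0
      · rw [dif_pos h', dif_pos h', map_zero, map_zero]
      · rw [dif_neg h', dif_neg h']
        exact cupProduct_two_left_comm _ _ B B' _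
  -- `L_{B+B'} = L_B + L_{B'}`
  have hadd : L (B + B') = L B + L B' := by
    refine LinearMap.ext fun f => funext fun j => ?_
    rw [LinearMap.add_apply, Pi.add_apply]
    simp only [hL]
    by_cases h : (j : ℕ) = 0
    · rw [dif_pos h, dif_pos h, dif_pos h, add_zero]
    · rw [dif_neg h, dif_neg h, dif_neg h, map_add, LinearMap.add_apply]
  -- the exponentials `E_A = Σ_{i ≤ k} L_A^i / i!` act as the `A`-twist on truncated families
  let E : complexBetti X 2 → Module.End ℂ ((j : Fin (k + 1)) → complexBetti X (2 * (j : ℕ))) := fun A =>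
    ∑ i ∈ Finset.range (k + 1), ((Nat.factorial i : ℕ) : ℂ)⁻¹ • L A ^ i
  have hE : ∀ A (μ : (j : ℕ) → complexBetti X (2 * j)),
      E A (fun j : Fin (k + 1) => μ j) = fun j : Fin (k + 1) => expTwistClasses X A μ j := by
    intro A μ
    funext j
    have hj := j.2
    change (∑ i ∈ Finset.range (k + 1), ((Nat.factorial i : ℕ) : ℂ)⁻¹ • L A ^ i) (fun j => μ j) j = _
    rw [LinearMap.sum_apply, Finset.sum_apply]
    simp only [LinearMap.smul_apply, Pi.smul_apply, hpow]
    rw [← Finset.sum_subset (Finset.range_subset_range.2 (by omega : (j : ℕ) + 1 ≤ k + 1)) fun i _ hi => by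
      rw [dif_neg (by simpa [Finset.mem_range] using hi), smul_zero]]
    unfold expTwistClasses
    rw [Finset.sum_range (fun i => ((Nat.factorial i : ℕ) : ℂ)⁻¹ •
      if h : i ≤ (j : ℕ) then cupProduct (two_mul_add_two_mul_sub_of_le h) (cupPowTwo A i)
        ((fun j : Fin (k + 1) => μ j) ⟨(j : ℕ) - i, by omega⟩)
      else 0)]
    refine Finset.sum_congr rfl fun i _ => ?_
    rw [dif_pos (Nat.le_of_lt_succ i.2)]
  -- the exponential law for commuting nilpotent operators (Mathlib), scalars restricted along `ℚ → ℂ`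
  have hEadd : E (B + B') = E B * E B' := by
    letI : Module ℚ (Module.End ℂ ((j : Fin (k + 1)) → complexBetti X (2 * (j : ℕ)))) :=
      Module.compHom _ (algebraMap ℚ ℂ)
    have hexp : ∀ A, E A = IsNilpotent.exp (L A) := fun A => by
      rw [IsNilpotent.exp_eq_sum (hnil A)]
      refine Finset.sum_congr rfl fun i _ => ?_
      change _ = (algebraMap ℚ ℂ ((Nat.factorial i : ℚ)⁻¹)) • L A ^ i
      rw [map_inv₀, map_natCast]
    rw [hexp, hexp, hexp, hadd]
    exact IsNilpotent.exp_add_of_commute hcomm ⟨k + 1, hnil B⟩ ⟨k + 1, hnil B'⟩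
  -- read off the degree-`k` component
  have h1 := congrFun (hE (B + B') κ) (Fin.last k)
  have h2 := congrFun (hE B (expTwistClasses X B' κ)) (Fin.last k)
  change E (B + B') (fun j : Fin (k + 1) => κ j) (Fin.last k) = _ at h1
  change E B (fun j : Fin (k + 1) => expTwistClasses X B' κ j) (Fin.last k) = _ at h2
  change expTwistClasses X (B + B') κ ((Fin.last k : Fin (k + 1)) : ℕ) =
    expTwistClasses X B (expTwistClasses X B' κ) ((Fin.last k : Fin (k + 1)) : ℕ)
  rw [← h1, ← h2, hEadd, Module.End.mul_apply, hE B' κ]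

/-- **Two twists commute**: `e^{B} ∪ (e^{B'} ∪ κ) = e^{B'} ∪ (e^{B} ∪ κ)`. [cite: HuybrechtsStellari2005, §1] -/
theorem expTwistClasses_comm (B B' : complexBetti X 2) (κ : (j : ℕ) → complexBetti X (2 * j)) (k : ℕ) :
    expTwistClasses X B (expTwistClasses X B' κ) k = expTwistClasses X B' (expTwistClasses X B κ) k := by
  rw [← expTwistClasses_add, add_comm, expTwistClasses_add]

/-- **Untwisting**: `e^{-B} ∪ (e^{B} ∪ κ) = κ`. [cite: HuybrechtsStellari2005, §1] -/
theorem expTwistClasses_neg_expTwistClasses (B : complexBetti X 2) (κ : (j : ℕ) → complexBetti X (2 * j)) (k : ℕ) :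
    expTwistClasses X (-B) (expTwistClasses X B κ) k = κ k := by
  rw [← expTwistClasses_add, neg_add_cancel, expTwistClasses_zero]

/-- **Untwisting**: `e^{B} ∪ (e^{-B} ∪ κ) = κ`. [cite: HuybrechtsStellari2005, §1] -/
theorem expTwistClasses_expTwistClasses_neg (B : complexBetti X 2) (κ : (j : ℕ) → complexBetti X (2 * j)) (k : ℕ) :
    expTwistClasses X B (expTwistClasses X (-B) κ) k = κ k := by
  rw [← expTwistClasses_add, add_neg_cancel, expTwistClasses_zero]

/-- **Change of `B`-field**: `e^{B'} ∪ κ = e^{B' - B} ∪ (e^{B} ∪ κ)`. [cite: HuybrechtsStellari2005, §1]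
[cite: Markman2025SecantWeil, §7.3] -/
theorem expTwistClasses_eq_expTwistClasses_sub (B B' : complexBetti X 2) (κ : (j : ℕ) → complexBetti X (2 * j)) (k : ℕ) :
    expTwistClasses X B' κ k = expTwistClasses X (B' - B) (expTwistClasses X B κ) k := by
  rw [← expTwistClasses_add, sub_add_cancel]

/-- **The twist is injective on families**: `e^{B} ∪ κ = e^{B} ∪ κ'` in all degrees `≤ k` forces `κ_k = κ'_k`.
[cite: HuybrechtsStellari2005, §1] -/
theorem expTwistClasses_injective {B : complexBetti X 2} {κ κ' : (j : ℕ) → complexBetti X (2 * j)}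
    (h : ∀ j, expTwistClasses X B κ j = expTwistClasses X B κ' j) (k : ℕ) : κ k = κ' k := by
  rw [← expTwistClasses_neg_expTwistClasses X B κ k, ← expTwistClasses_neg_expTwistClasses X B κ' k,
    (funext h : expTwistClasses X B κ = expTwistClasses X B κ')]

/-- **Additivity in the family**: `e^{B} ∪ (κ + κ') = e^{B} ∪ κ + e^{B} ∪ κ'`. [cite: HatcherAT2002, §3.2] -/
theorem expTwistClasses_add_family (B : complexBetti X 2) (κ κ' : (j : ℕ) → complexBetti X (2 * j)) (k : ℕ) :
    expTwistClasses X B (fun j => κ j + κ' j) k = expTwistClasses X B κ k + expTwistClasses X B κ' k := by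
  unfold expTwistClasses
  rw [← Finset.sum_add_distrib]
  refine Finset.sum_congr rfl fun i _ => ?_
  rw [map_add, smul_add]

/-- **Homogeneity in the family**: `e^{B} ∪ (c·κ) = c·(e^{B} ∪ κ)`. [cite: HatcherAT2002, §3.2] -/
theorem expTwistClasses_smul_family (B : complexBetti X 2) (c : ℂ) (κ : (j : ℕ) → complexBetti X (2 * j)) (k : ℕ) :
    expTwistClasses X B (fun j => c • κ j) k = c • expTwistClasses X B κ k := by
  unfold expTwistClasses
  rw [Finset.smul_sum]
  refine Finset.sum_congr rfl fun i _ => ?_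
  rw [map_smul, smul_comm]

end ExponentialLaw

/-! ### §3 The components of degrees `0` and `1` -/

section LowDegrees

variable (X : SchemeOver ℂ)

/-- **Degree `0`: `(e^{B} ∪ κ)_0 = κ_0`** (the single term `B⁰ ∪ κ_0 = 1 ∪ κ_0`). [cite: HuybrechtsStellari2005, §1] -/
theorem expTwistClasses_apply_zero (B : complexBetti X 2) (κ : (j : ℕ) → complexBetti X (2 * j)) :
    expTwistClasses X B κ 0 = κ 0 := by
  unfold expTwistClasses
  rw [Fin.sum_univ_one]
  change ((Nat.factorial 0 : ℕ) : ℂ)⁻¹ • cupProduct _ (cupPowTwo B 0) (κ 0) = κ 0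
  rw [Nat.factorial_zero, Nat.cast_one, inv_one, one_smul, cupPowTwo_zero]
  exact one_cupProduct _

/-- Degree bookkeeping `2 + 2·0 = 2·1` (private plumbing; any proof of this equation may be supplied by a user, by proof
irrelevance). [folklore] -/
private theorem two_add_two_mul_zero : 2 + 2 * 0 = 2 * 1 := rfl

/-- **Degree `1`: `(e^{B} ∪ κ)_1 = κ_1 + B ∪ κ_0`** (the terms `B⁰ ∪ κ_1` and `B¹ ∪ κ_0`; the product `B ∪ κ_0 ∈ H^{2·1}` is
`cupProduct h B (κ 0)` for any `h : 2 + 2 * 0 = 2 * 1`, all such terms being equal). [cite: HuybrechtsStellari2005, §1] -/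
theorem expTwistClasses_apply_one (B : complexBetti X 2) (κ : (j : ℕ) → complexBetti X (2 * j)) :
    expTwistClasses X B κ 1 = κ 1 + cupProduct two_add_two_mul_zero B (κ 0) := by
  unfold expTwistClasses
  rw [Fin.sum_univ_succ, Fin.sum_univ_one]
  congr 1
  · change ((Nat.factorial 0 : ℕ) : ℂ)⁻¹ • cupProduct _ (cupPowTwo B 0) (κ 1) = κ 1
    rw [Nat.factorial_zero, Nat.cast_one, inv_one, one_smul, cupPowTwo_zero]
    exact one_cupProduct _
  · change ((Nat.factorial 1 : ℕ) : ℂ)⁻¹ • cupProduct _ (cupPowTwo B 1) (κ 0) = _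
    rw [Nat.factorial_one, Nat.cast_one, inv_one, one_smul, cupPowTwo_one]

end LowDegrees

/-! ### §4 Ray stability: twisting by a multiple of `θ` keeps classes on the `θ`-ray -/

section Ray

variable (X : SchemeOver ℂ)

/-- **`(t·θ)ⁱ ∪ (c·θʳ) = (tⁱ c)·θ^{i+r}`** — a term of `e^{tθ} ∪ κ` against a class on the `θ`-ray stays on the ray.
[cite: HatcherAT2002, §3.2] -/
theorem cupProduct_cupPowTwo_smul_of_eq_smul {θ : complexBetti X 2} (t : ℂ) {i r q : ℕ} (hm : i + r = q)
    (h : 2 * i + 2 * r = 2 * q) {y : complexBetti X (2 * r)} {c : ℂ} (hy : y = c • cupPowTwo θ r) :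
    cupProduct h (cupPowTwo (t • θ) i) y = (t ^ i * c) • cupPowTwo θ q := by
  rw [hy, Literature.AlgebraicGeometry.Hyperkaehler.cupPowTwo_smul]
  simp only [map_smul, LinearMap.smul_apply, smul_smul]
  rw [cupProduct_cupPowTwo_cupPowTwo θ hm h, mul_comm c]

/-- **RAY STABILITY OF THE `θ`-TWIST.** If `κ_q = c_q·θ^q` for every `q < p`, then for every `t ∈ ℂ` there are scalars `c'_q` with
`(e^{tθ} ∪ κ)_q = c'_q·θ^q` for all `q < p` AND `(e^{tθ} ∪ κ)_p = κ_p + c'_p·θᵖ` — twisting by a class on the polarisation ray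
changes the first off-ray class only by a multiple of `θᵖ` and keeps all lower classes on the ray (explicitly
`c'_q = Σ_{i ≤ q} tⁱ c_{q-i}/i!` for `q < p` and `c'_p = Σ_{1 ≤ i ≤ p} tⁱ c_{p-i}/i!`). This is the computation behind «Markman's
normalisation loses nothing»: moving the `B`-field `B₀ ↦ B₀ + tθ` along the ray preserves the shape
«lower classes on the ray, `κ_p ≡ a·w (mod ℂθᵖ)`». [cite: Markman2025SecantWeil, §1.1 and §7.3] [cite: HuybrechtsStellari2005, §1] -/
theorem exists_expTwistClasses_smul_onRay {θ : complexBetti X 2} {κ : (j : ℕ) → complexBetti X (2 * j)} {p : ℕ} (t : ℂ)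
    (c : ℕ → ℂ) (hκ : ∀ q < p, κ q = c q • cupPowTwo θ q) :
    ∃ c' : ℕ → ℂ, (∀ q < p, expTwistClasses X (t • θ) κ q = c' q • cupPowTwo θ q) ∧
      expTwistClasses X (t • θ) κ p = κ p + c' p • cupPowTwo θ p := by
  refine ⟨fun q => if q < p then ∑ i : Fin (q + 1), ((Nat.factorial (i : ℕ) : ℕ) : ℂ)⁻¹ * (t ^ (i : ℕ) * c (q - i))
      else ∑ i : Fin p, ((Nat.factorial ((i : ℕ) + 1) : ℕ) : ℂ)⁻¹ * (t ^ ((i : ℕ) + 1) * c (p - ((i : ℕ) + 1))),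
    fun q hq => ?_, ?_⟩
  · dsimp only
    rw [if_pos hq, Finset.sum_smul]
    unfold expTwistClasses
    refine Finset.sum_congr rfl fun i _ => ?_
    rw [cupProduct_cupPowTwo_smul_of_eq_smul X t (by omega : (i : ℕ) + (q - i) = q) _ (hκ _ (by omega)), smul_smul]
  · dsimp only
    rw [if_neg (lt_irrefl p), Finset.sum_smul]
    unfold expTwistClasses
    rw [Fin.sum_univ_succ]
    congr 1
    · change ((Nat.factorial 0 : ℕ) : ℂ)⁻¹ • cupProduct _ (cupPowTwo (t • θ) 0) (κ p) = κ p
      rw [Nat.factorial_zero, Nat.cast_one, inv_one, one_smul, cupPowTwo_zero]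
      exact one_cupProduct _
    · refine Finset.sum_congr rfl fun i _ => ?_
      change ((Nat.factorial ((i : ℕ) + 1) : ℕ) : ℂ)⁻¹ • cupProduct _ (cupPowTwo (t • θ) ((i : ℕ) + 1)) (κ (p - ((i : ℕ) + 1))) = _
      rw [cupProduct_cupPowTwo_smul_of_eq_smul X t (by omega : ((i : ℕ) + 1) + (p - ((i : ℕ) + 1)) = p) _ (hκ _ (by omega)),
        smul_smul]

/-- **Ray stability, membership form**: if every `κ_q`, `q < p`, lies on the `θ`-ray then so does every `(e^{tθ} ∪ κ)_q`, `q < p`,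
and `(e^{tθ} ∪ κ)_p - κ_p ∈ ℂ·θᵖ`. [cite: Markman2025SecantWeil, §1.1 and §7.3] [cite: HuybrechtsStellari2005, §1] -/
theorem expTwistClasses_smul_sub_mem_span_of_onRay {θ : complexBetti X 2} {κ : (j : ℕ) → complexBetti X (2 * j)} {p : ℕ}
    (t : ℂ) (hκ : ∀ q < p, κ q ∈ Submodule.span ℂ {cupPowTwo θ q}) :
    (∀ q < p, expTwistClasses X (t • θ) κ q ∈ Submodule.span ℂ {cupPowTwo θ q}) ∧
      expTwistClasses X (t • θ) κ p - κ p ∈ Submodule.span ℂ {cupPowTwo θ p} := by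
  choose c hc using fun q (hq : q < p) => Submodule.mem_span_singleton.1 (hκ q hq)
  obtain ⟨c', hc', hp⟩ := exists_expTwistClasses_smul_onRay X t (fun q => if h : q < p then c q h else 0)
    (fun q hq => by rw [dif_pos hq]; exact (hc q hq).symm)
  refine ⟨fun q hq => Submodule.mem_span_singleton.2 ⟨c' q, (hc' q hq).symm⟩, Submodule.mem_span_singleton.2 ⟨c' p, ?_⟩⟩
  rw [hp, add_sub_cancel_left]

end Ray

end Literature.AlgebraicGeometry.HodgeTheory

end
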